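import Summits.HodgeConjecture.CorCM.Census.QuaternionColumnEvenLaw
import Summits.HodgeConjecture.CorCM.Census.TypeStabiliserCharK

/-!
# The quaternion column at EVEN level, VI: the closed form `φ₂(Q_{4n}, c) = β(Q_{4n}, c)` and the law `μ = β` for every even `n ≥ 4`

COR-CM (cell `pub-hodgecm2`), count-neutral kernel combinatorics by the binder seat b09 (gen 40; lane RELATIVE SPLITTING, part X), on lit-andre-3ʼs closed form
`TypeStabiliser.fibreTwo_add_two_eq_card_block_add_indexTwoRank` (`φ₂ + 2 = β + d₂(G/𝒦)` when `|G|/2` is even), `TypeStabiliser.two_pow_indexTwoRank_stabGen`,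
`IndexTwo.card_indexTwo_add_one`, `TypeStabiliser.stabGen_le_iff_subset`, gen 39ʼs characters `chiA`, `chiB` and gen 40ʼs law
`isLeast_card_gfaces_generate_quaternion_even_law`, all BY NAME.  Theorems only: no definition, no `decide` beyond closed identities in `ZMod 2`, no certificate,
no named fact, no `sorry`.
HONEST FRAMING: `HC_CM` is NOT proved, here or anywhere in the tree; nothing here is a period or a headline.

* §1 `Q_{4n}` (`n` even) has exactly FOUR sign characters `Q_{4n} → ℤ/2` (`natCard_signChar_eq_four`: they are determined by the images of `a 1`, `xa 0`, and
  `χ_a`, `χ_b` realise every pair of values), hence exactly three subgroups of index two.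
* §2 Every subgroup of index two contains the type-stabiliser subgroup `𝒦 = ⟨c, {g : c ∉ ⟨g⟩}⟩` (`stabGen_le_of_index_two`: `c = (xa 0)²`, and a rotation `a i`
  whose cyclic group misses `c` has EVEN index `i` — an odd one reaches `c` by Bézout, `exists_pow_a_eq_c_of_odd` — so is the square `(a (i/2))²`); therefore
  `d₂(Q_{4n}/𝒦) = 2` (`indexTwoRank_stabGen_eq_two`).
* §3 **`φ₂(Q_{4n}, c) = β(Q_{4n}, c)`** (`fibreTwo_eq_card_block`), and **THE LAW IN CLOSED FORM** (`isLeast_card_gfaces_generate_quaternion_even_card_block`):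
  for every even `n ≥ 4` the least number of face relations whose base changes generate the Hodge lattice of `(Q_{4n}, c)` modulo pairs is EXACTLY the number
  `β` of blocks (`G`-orbits of CM types) — gen 38/39ʼs prediction `μ(Q_{4M}) = β` for the whole even column.

## References
* [Pohlmann1968] H. Pohlmann, Algebraic cycles on abelian varieties of complex multiplication type, Ann. of Math. 88 (1968), Thm 1.
-/

namespace Summit.HodgeConjecture.CorCM.Census.QuaternionColumn

open Finset QuaternionGroup
open Summit.HodgeConjecture.CorCM.Prior.AllgGroup.RfwfAllgGroup
open Summit.HodgeConjecture.CorCM.Census.BlockParity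
open Summit.HodgeConjecture.CorCM.Census.Coinvariant
open Summit.HodgeConjecture.CorCM.Census.TypeStabiliser
open Summit.HodgeConjecture.CorCM.Census.IndexTwo

noncomputable section

variable {n : ℕ} [NeZero n]

/-! ## §1 The four sign characters of `Q_{4n}` (`n` even) -/

/-- A sign character of `Q_{4n}` is determined by its values at `a 1` and `xa 0`. [folklore] -/
theorem signChar_ext {φ ψ : QuaternionGroup n →* Multiplicative (ZMod 2)} (h1 : φ (a 1) = ψ (a 1)) (h2 : φ (xa 0) = ψ (xa 0)) : φ = ψ := by
  refine MonoidHom.ext fun g => ?_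
  cases g with
  | a i =>
    have e : (a i : QuaternionGroup n) = (a 1) ^ i.val := by rw [a_one_pow, ZMod.natCast_zmod_val]
    rw [e, map_pow, map_pow, h1]
  | xa j =>
    have e : (xa j : QuaternionGroup n) = xa 0 * (a 1) ^ j.val := by rw [a_one_pow, ZMod.natCast_zmod_val, xa_mul_a, zero_add]
    rw [e, map_mul, map_mul, map_pow, map_pow, h1, h2]

/-- **`Q_{4n}` has exactly four sign characters** when `n` is even: evaluation at `(a 1, xa 0)` is a bijection onto `(ℤ/2)²`, the characters
`u·χ_b + v·χ_a` realising every pair. [folklore] -/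
theorem natCard_signChar_eq_four (heven : Even n) : Nat.card (QuaternionGroup n →* Multiplicative (ZMod 2)) = 4 := by
  set ev : (QuaternionGroup n →* Multiplicative (ZMod 2)) → Multiplicative (ZMod 2) × Multiplicative (ZMod 2) :=
    fun φ => (φ (a 1), φ (xa 0)) with hev
  have hbij : Function.Bijective ev := by
    refine ⟨fun φ ψ h => ?_, fun uv => ?_⟩
    · simp only [hev, Prod.mk.injEq] at h
      exact signChar_ext h.1 h.2
    · -- the character `u·χ_b + v·χ_a`
      set χ : QuaternionGroup n → ZMod 2 := fun g => Multiplicative.toAdd uv.1 * chiB g + Multiplicative.toAdd uv.2 * chiA g with hχ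
      have hadd : ∀ g h : QuaternionGroup n, χ (g * h) = χ g + χ h := fun g h => by
        simp only [hχ, chiB_mul heven, chiA_mul]; ring
      refine ⟨addHom χ hadd, ?_⟩
      simp only [hev, addHom_apply, hχ, chiA, chiB, map_one, map_zero, mul_one, mul_zero, add_zero, zero_add]
      rfl
  rw [Nat.card_eq_of_bijective ev hbij, Nat.card_prod, Nat.card_eq_fintype_card, Fintype.card_multiplicative, ZMod.card]

/-! ## §2 Every index-two subgroup contains `𝒦`; `d₂(Q_{4n}/𝒦) = 2` -/

/-- An odd rotation reaches `c`: if `i` is odd then `(a i)^t = c` for some `t` (Bézout, every `n`). [folklore] -/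
theorem exists_pow_a_eq_c_of_odd (i : ZMod (2 * n)) (hi : Odd i.val) : ∃ t : ℕ, (a i : QuaternionGroup n) ^ t = c n := by
  have hn := NeZero.ne n
  obtain ⟨t, ht⟩ : ∃ t : ZMod (2 * n), t * i = (n : ZMod (2 * n)) := by
    set g := Nat.gcd i.val (2 * n) with hg
    have hgodd : Odd g := hi.of_dvd_nat (Nat.gcd_dvd_left _ _)
    have hg2n : g ∣ n * 2 := by rw [mul_comm]; exact Nat.gcd_dvd_right _ _
    have hgn : g ∣ n := (Nat.coprime_two_right.mpr hgodd).dvd_of_dvd_mul_right hg2n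
    have hbez : ((g : ℤ) : ZMod (2 * n)) = ((i.val : ℤ) : ZMod (2 * n)) * ((Nat.gcdA i.val (2 * n) : ℤ) : ZMod (2 * n)) := by
      have e := Nat.gcd_eq_gcd_ab i.val (2 * n)
      rw [← hg] at e
      have h0 : (((2 * n : ℕ) : ℤ) : ZMod (2 * n)) = 0 := by rw [Int.cast_natCast, ZMod.natCast_self]
      apply_fun (fun z : ℤ => (z : ZMod (2 * n))) at e
      rw [Int.cast_add, Int.cast_mul, Int.cast_mul, h0, zero_mul, add_zero] at e
      exact e
    refine ⟨((n / g : ℕ) : ZMod (2 * n)) * ((Nat.gcdA i.val (2 * n) : ℤ) : ZMod (2 * n)), ?_⟩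
    rw [Int.cast_natCast, Int.cast_natCast, ZMod.natCast_zmod_val] at hbez
    rw [mul_assoc, mul_comm _ i, ← hbez, ← Nat.cast_mul, Nat.div_mul_cancel hgn]
  exact ⟨t.val, by rw [a_pow, ZMod.natCast_zmod_val, ht]; rfl⟩

/-- **Every subgroup of index two of `Q_{4n}` contains `𝒦`**: `c = (xa 0)²` is a square, and a generator `g` of `𝒦` with `c ∉ ⟨g⟩` is a rotation of even
index, hence a square. [folklore] -/
theorem stabGen_le_of_index_two {H : Subgroup (QuaternionGroup n)} (hH : H.index = 2) : stabGen (c n) ≤ H := by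
  rw [stabGen_le_iff_subset]
  refine ⟨?_, fun g hg => ?_⟩
  · have h := Subgroup.mul_self_mem_of_index_two hH (xa (0 : ZMod (2 * n)))
    rwa [xa_mul_xa_self] at h
  · cases g with
    | xa j =>
      exact absurd (by rw [← xa_mul_xa_self j, ← pow_two]; exact Subgroup.pow_mem _ (Subgroup.mem_zpowers _) 2) hg
    | a i =>
      -- `i` is even, else `c ∈ ⟨a i⟩`
      have heven : ¬ Odd i.val := fun hodd => by
        obtain ⟨t, ht⟩ := exists_pow_a_eq_c_of_odd i hodd
        exact hg (ht ▸ Subgroup.pow_mem _ (Subgroup.mem_zpowers _) t)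
      obtain ⟨k, hk⟩ := Nat.not_odd_iff_even.mp heven
      have e : (a i : QuaternionGroup n) = a (k : ZMod (2 * n)) * a (k : ZMod (2 * n)) := by
        rw [a_mul_a, ← Nat.cast_add, ← hk, ZMod.natCast_zmod_val]
      rw [e]
      exact Subgroup.mul_self_mem_of_index_two hH _

/-- **`d₂(Q_{4n}/𝒦) = 2`** for even `n`: all three index-two subgroups lie over `𝒦`. [folklore] -/
theorem indexTwoRank_stabGen_eq_two (heven : Even n) : indexTwoRank (stabGen (c n)) = 2 := by
  have h := two_pow_indexTwoRank_stabGen (c n) c_comm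
  have e : Nat.card {H : Subgroup (QuaternionGroup n) // H.index = 2 ∧ stabGen (c n) ≤ H} =
      Nat.card {H : Subgroup (QuaternionGroup n) // H.index = 2} :=
    Nat.card_congr (Equiv.subtypeEquivRight fun H => ⟨fun hH => hH.1, fun hH => ⟨hH, stabGen_le_of_index_two hH⟩⟩)
  rw [e, card_indexTwo_add_one, natCard_signChar_eq_four heven, show (4 : ℕ) = 2 ^ 2 by norm_num] at h
  exact Nat.pow_right_injective (le_refl 2) h

/-! ## §3 `φ₂ = β` and the law in closed form -/

/-- **`φ₂(Q_{4n}, c) = β(Q_{4n}, c)`** for even `n`: the coinvariant fibre dimension is the number of blocks. [folklore] -/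
theorem fibreTwo_eq_card_block (heven : Even n) : fibreTwo (c n) c_mul_c = Fintype.card (Block (c n)) := by
  have hG : Even (Fintype.card (QuaternionGroup n) / 2) := by
    rw [QuaternionGroup.card, show 4 * n / 2 = 2 * n by omega]; exact even_two_mul n
  have h := fibreTwo_add_two_eq_card_block_add_indexTwoRank (c n) c_mul_c c_ne_one c_comm hG
  rw [indexTwoRank_stabGen_eq_two heven] at h
  omega

/-- **THE QUATERNION LAW IN CLOSED FORM: `μ(Q_{4n}, c) = β(Q_{4n}, c)` for every even `n ≥ 4`** — the least number of rank-four face relations whose base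
changes generate the integer Hodge lattice of `(Q_{4n}, c)` modulo pairs is EXACTLY the number of `G`-orbits of CM types. [folklore] -/
theorem isLeast_card_gfaces_generate_quaternion_even_card_block (heven : Even n) (h4 : 4 ≤ n) :
    IsLeast {k : ℕ | ∃ S : Finset (CMF (QuaternionGroup n) (c n) →₀ ℤ), (↑S ⊆ gfaceSet (QuaternionGroup n) (c n) c_mul_c) ∧ S.card = k ∧
      hodgeSpan (c n) c_mul_c ≤ Submodule.span ℤ (pairSet (c n)) ⊔ Submodule.span ℤ (translates (c n) S)} (Fintype.card (Block (c n))) := by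
  rw [← fibreTwo_eq_card_block heven]
  exact isLeast_card_gfaces_generate_quaternion_even_law heven h4

end

end Summit.HodgeConjecture.CorCM.Census.QuaternionColumn
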